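import Literature.NumberTheory.LFunctions.FordProgram1
import HarnessLib

/-!
# Ford's "Program 1": kernel run 31A (`1008 ≤ k ≤ 1013`)

Topic `Literature/NumberTheory/LFunctions`. Everything here is PROVED (kernel evaluations, standard
axioms): `FordP1.checkT k = true` for `1008 ≤ k ≤ 1013`, i.e. the certified re-run of PROGRAM 1 of
K. Ford, Proc. LMS 85 (2002) (the second part of Theorem 3) for these `k` — see `FordProgram1.lean`
for the checker, its soundness `FordP1.row_of_checkK`, and the meaning of the constants
(`ρ = FordP1.rhoOf k / 10⁵`, `θ = FordP1.thetaOf k / 10⁴`, `ω = FordP1.omOf k / 10⁴`). One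
`decide +kernel` per `k` (so that the kernel's evaluation state is bounded by a single run;
`maxHeartbeats 0` lifts the deterministic time-out for each), then the range statement
`FordP1.run31A`. The assembly is `FordTheorem3SmallK.lean`.

## References

* K. Ford, Proc. London Math. Soc. (3) 85 (2002), 565–633; arXiv:1910.08209: Theorem 3, (1.7),
  Lemmas 3.4–3.5, Appendix "PROGRAM 1". [Ford2002]
-/

namespace Literature.NumberTheory.LFunctions
namespace FordP1

set_option maxHeartbeats 0 in
/-- `checkT 1008`. [cite: Ford2002, Theorem 3 (second part) and PROGRAM 1] -/
theorem checkT_1008 : checkT 1008 = true := by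
  decide +kernel

set_option maxHeartbeats 0 in
/-- `checkT 1009`. [cite: Ford2002, Theorem 3 (second part) and PROGRAM 1] -/
theorem checkT_1009 : checkT 1009 = true := by
  decide +kernel

set_option maxHeartbeats 0 in
/-- `checkT 1010`. [cite: Ford2002, Theorem 3 (second part) and PROGRAM 1] -/
theorem checkT_1010 : checkT 1010 = true := by
  decide +kernel

set_option maxHeartbeats 0 in
/-- `checkT 1011`. [cite: Ford2002, Theorem 3 (second part) and PROGRAM 1] -/
theorem checkT_1011 : checkT 1011 = true := by
  decide +kernel

set_option maxHeartbeats 0 in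
/-- `checkT 1012`. [cite: Ford2002, Theorem 3 (second part) and PROGRAM 1] -/
theorem checkT_1012 : checkT 1012 = true := by
  decide +kernel

set_option maxHeartbeats 0 in
/-- `checkT 1013`. [cite: Ford2002, Theorem 3 (second part) and PROGRAM 1] -/
theorem checkT_1013 : checkT 1013 = true := by
  decide +kernel

/-- **Kernel run 31A**: `checkT k` for `1008 ≤ k ≤ 1013`. [cite: Ford2002, Theorem 3 (second part)
and PROGRAM 1] -/
theorem run31A (k : ℕ) (h1 : 1008 ≤ k) (h2 : k ≤ 1013) : checkT k = true := by
  interval_cases k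
  · exact checkT_1008
  · exact checkT_1009
  · exact checkT_1010
  · exact checkT_1011
  · exact checkT_1012
  · exact checkT_1013

end FordP1
end Literature.NumberTheory.LFunctions
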